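import Summits.CriticalPhenomena.PercolationContinuityZ3.Theorems.Transplant.FKConnectivityAllQAntipodalRootForm3RealDefs
import Summits.CriticalPhenomena.PercolationContinuityZ3.Theorems.Transplant.FKConnectivityAllQAntipodalRootFormGenRelabel
import Summits.CriticalPhenomena.PercolationContinuityZ3.Theorems.Transplant.FKConnectivityAllQAntipodalRootFormGenAttachPFacts
import Summits.CriticalPhenomena.PercolationContinuityZ3.Theorems.Transplant.FKConnectivityAllQAntipodalRootFormGenAttachSPar
import Summits.CriticalPhenomena.PercolationContinuityZ3.Theorems.Transplant.FKConnectivityAllQAntipodalRootFormRealAttach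
import Summits.CriticalPhenomena.PercolationContinuityZ3.Theorems.Transplant.FKConnectivityAllQAntipodalRootFormGeneral

/-!
# Connectivity correlation inequalities for `φ_{w,q}`, every `q > 0` — ROOT-FORM CALCULUS, file 74e: REAL series / parallel ATTACHMENTS of a
# special-free box to a three-special environment, pole symmetry, and the order of the three specials

Support file (`--supports stmt-CriticalPhenomena-4575`), FK sub-lane `prim-bschramm-fk-2` (gen 32); builds on p205010 (kernel theorem,
internal audit signed; external expert review pending).  No definitions, no named facts, no sorries; standard axioms.  Memo
FROM-fk-2-g31-DUALITY.md §6 (G4), FROM-fk-2-g32-*.md; FK-Q2 §41.  This is file 61x (`realEnv_attP_facts` / `realEnv_attS_facts`) for three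
specials, on top of the generic attachment engine 61δ–61η (`Gen.gattP_facts`, `Gen.gattS_facts`):
* `realEnv3_attP_facts`, `realEnv3_attS_facts` — the five facts of the generic word theorem pass from the real three-special environment of `𝓔`
  to those of `A ∥ 𝓔` and `B · 𝓔` (`A`, `B` two-terminal series–parallel, special-free): the real environment of the glued edge set is
  `Gen.attP` / `Gen.attS` of the real data (`FK.RootForm.acomb_realSDat0` / `scomb_realSDat0`, every level lowered by `2|V|`), transported by
  `Gen.gtransfer_facts` (61γ) along `(α, β) ↦ α ∪ β`;
* `realEnv3_pole_comm` — the environment does not see the order of the poles;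
* `realEnv3_facts_of_swap`, `realEnv3_facts_of_rot` — nor the order of the three specials (file 61θ `Gen.gfacts_of_relabel` with the
  transposition `(z w)` and the 3-cycle, `realEnv3_d_swap` / `realEnv3_d_rot`).
[cite: Grimmett2006, §1.4 eq. (1.20) (p. 15); §3.8 Thm. (3.90) (pp. 61–62)] [cite: Wagner2006, Thm. 5.8(d), §5.3]
-/

noncomputable section

namespace Summit.CriticalPhenomena.PercolationContinuityZ3.Theorems

namespace FK

namespace RootForm

open SimpleGraph Finset Literature.Probability.LatticeModels Literature.Probability.Percolation
open scoped Classical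

variable {V : Type*} [Fintype V]

section Symmetry

variable {M C : Finset (Sym2 V)} {a b : V} {y z w : Sym2 V}

/-- The real three-special environment does not see the order of the poles. [folklore] -/
theorem realEnv3_pole_comm (M C : Finset (Sym2 V)) (a b : V) (y z w : Sym2 V) : realEnv3 M C a b y z w = realEnv3 M C b a y z w := by
  funext β
  simp only [realEnv3, realPDat, reachB_comm _ a b]

omit [Fintype V] in
/-- two conditional insertions commute. [folklore] -/
theorem insIf_comm {p q : Prop} [Decidable p] [Decidable q] (e f : Sym2 V) (X : Finset (Sym2 V)) :
    insIf p e (insIf q f X) = insIf q f (insIf p e X) := by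
  unfold insIf; split_ifs
  · exact Finset.insert_comm _ _ _
  · rfl
  · rfl
  · rfl

/-- Swapping the last two specials relabels the patterns by the transposition `(1 2)`. [folklore] -/
theorem realEnv3_d_swap (β : ↥M.powerset) (P : Finset (Fin 3)) :
    (realEnv3 M C a b y w z β).d P = (realEnv3 M C a b y z w β).d (P.map (Equiv.swap (1 : Fin 3) 2).toEmbedding) := by
  have hX : patSet3 y w z P β.1 = patSet3 y z w (P.map (Equiv.swap (1 : Fin 3) 2).toEmbedding) β.1 := by
    have s0 : (Equiv.swap (1 : Fin 3) 2) 0 = 0 := by decide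
    have s1 : (Equiv.swap (1 : Fin 3) 2) 1 = 2 := by decide
    have s2 : (Equiv.swap (1 : Fin 3) 2) 2 = 1 := by decide
    simp only [patSet3]
    rw [insIf_comm w z]
    congr 1
    · rw [Finset.mem_map_equiv, Equiv.symm_swap, s0]
    · congr 1
      · rw [Finset.mem_map_equiv, Equiv.symm_swap, s1]
      · congr 1
        rw [Finset.mem_map_equiv, Equiv.symm_swap, s2]
  rw [realEnv3_d, realEnv3_d, hX]
  simp only [realPDat, Finset.insert_comm w z]

/-- Rotating the specials relabels the patterns by the 3-cycle. [folklore] -/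
theorem realEnv3_d_rot (β : ↥M.powerset) (P : Finset (Fin 3)) :
    (realEnv3 M C a b y z w β).d P = (realEnv3 M C a b z w y β).d (P.map (finRotate 3).symm.toEmbedding) := by
  have hX : patSet3 y z w P β.1 = patSet3 z w y (P.map (finRotate 3).symm.toEmbedding) β.1 := by
    have r0 : (finRotate 3) 0 = 1 := by decide
    have r1 : (finRotate 3) 1 = 2 := by decide
    have r2 : (finRotate 3) 2 = 0 := by decide
    simp only [patSet3]
    rw [insIf_comm y z, insIf_comm y w]
    congr 1
    · rw [Finset.mem_map_equiv, Equiv.symm_symm, r0]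
    · congr 1
      · rw [Finset.mem_map_equiv, Equiv.symm_symm, r1]
      · congr 1
        rw [Finset.mem_map_equiv, Equiv.symm_symm, r2]
  rw [realEnv3_d, realEnv3_d, hX]
  simp only [realPDat, Finset.insert_comm w y, Finset.insert_comm z y]

/-- **The five facts do not see a swap of the last two specials.** [folklore] -/
theorem realEnv3_facts_of_swap
    (h5 : (∀ h0 h1 : ↥M.powerset → ℝ, Monotone h0 → Monotone h1 → (∀ γ, 0 ≤ h0 γ) → (∀ γ, h0 γ ≤ h1 γ) → ∀ J : ℤ,
        0 ≤ Gen.gMt (realEnv3 M C a b y w z) h0 h1 J)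
      ∧ (∀ h0 h1 : Bool × ↥M.powerset → ℝ, Monotone h0 → Monotone h1 → (∀ p, 0 ≤ h0 p) → (∀ p, h0 p ≤ h1 p) → ∀ J : ℤ,
        0 ≤ Gen.gMt (Gen.parE (realEnv3 M C a b y w z)) h0 h1 J)
      ∧ (∀ h : ↥M.powerset → ℝ, Monotone h → (∀ γ, 0 ≤ h γ) → ∀ J : ℤ, 0 ≤ ∑ γ, h γ * (realEnv3 M C a b y w z γ).gandDel J)
      ∧ (∀ h : ↥M.powerset → ℝ, Monotone h → (∀ γ, 0 ≤ h γ) → ∀ J : ℤ, 0 ≤ ∑ γ, h γ * (realEnv3 M C a b y w z γ).gandCon J)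
      ∧ (∀ h0 h1 : ↥M.powerset → ℝ, Monotone h0 → Monotone h1 → (∀ γ, 0 ≤ h0 γ) → (∀ γ, h0 γ ≤ h1 γ) → ∀ J : ℤ,
          0 ≤ ∑ γ, (h1 γ * (realEnv3 M C a b y w z γ).gandE1 J + h0 γ * (realEnv3 M C a b y w z γ).gandE2 J))) :
    (∀ h0 h1 : ↥M.powerset → ℝ, Monotone h0 → Monotone h1 → (∀ γ, 0 ≤ h0 γ) → (∀ γ, h0 γ ≤ h1 γ) → ∀ J : ℤ,
        0 ≤ Gen.gMt (realEnv3 M C a b y z w) h0 h1 J)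
      ∧ (∀ h0 h1 : Bool × ↥M.powerset → ℝ, Monotone h0 → Monotone h1 → (∀ p, 0 ≤ h0 p) → (∀ p, h0 p ≤ h1 p) → ∀ J : ℤ,
        0 ≤ Gen.gMt (Gen.parE (realEnv3 M C a b y z w)) h0 h1 J)
      ∧ (∀ h : ↥M.powerset → ℝ, Monotone h → (∀ γ, 0 ≤ h γ) → ∀ J : ℤ, 0 ≤ ∑ γ, h γ * (realEnv3 M C a b y z w γ).gandDel J)
      ∧ (∀ h : ↥M.powerset → ℝ, Monotone h → (∀ γ, 0 ≤ h γ) → ∀ J : ℤ, 0 ≤ ∑ γ, h γ * (realEnv3 M C a b y z w γ).gandCon J)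
      ∧ (∀ h0 h1 : ↥M.powerset → ℝ, Monotone h0 → Monotone h1 → (∀ γ, 0 ≤ h0 γ) → (∀ γ, h0 γ ≤ h1 γ) → ∀ J : ℤ,
          0 ≤ ∑ γ, (h1 γ * (realEnv3 M C a b y z w γ).gandE1 J + h0 γ * (realEnv3 M C a b y z w γ).gandE2 J)) :=
  Gen.gfacts_of_relabel (Equiv.swap (1 : Fin 3) 2) (fun β P => realEnv3_d_swap (y := y) (z := w) (w := z) β P) h5

/-- **The five facts do not see a rotation of the three specials.** [folklore] -/
theorem realEnv3_facts_of_rot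
    (h5 : (∀ h0 h1 : ↥M.powerset → ℝ, Monotone h0 → Monotone h1 → (∀ γ, 0 ≤ h0 γ) → (∀ γ, h0 γ ≤ h1 γ) → ∀ J : ℤ,
        0 ≤ Gen.gMt (realEnv3 M C a b z w y) h0 h1 J)
      ∧ (∀ h0 h1 : Bool × ↥M.powerset → ℝ, Monotone h0 → Monotone h1 → (∀ p, 0 ≤ h0 p) → (∀ p, h0 p ≤ h1 p) → ∀ J : ℤ,
        0 ≤ Gen.gMt (Gen.parE (realEnv3 M C a b z w y)) h0 h1 J)
      ∧ (∀ h : ↥M.powerset → ℝ, Monotone h → (∀ γ, 0 ≤ h γ) → ∀ J : ℤ, 0 ≤ ∑ γ, h γ * (realEnv3 M C a b z w y γ).gandDel J)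
      ∧ (∀ h : ↥M.powerset → ℝ, Monotone h → (∀ γ, 0 ≤ h γ) → ∀ J : ℤ, 0 ≤ ∑ γ, h γ * (realEnv3 M C a b z w y γ).gandCon J)
      ∧ (∀ h0 h1 : ↥M.powerset → ℝ, Monotone h0 → Monotone h1 → (∀ γ, 0 ≤ h0 γ) → (∀ γ, h0 γ ≤ h1 γ) → ∀ J : ℤ,
          0 ≤ ∑ γ, (h1 γ * (realEnv3 M C a b z w y γ).gandE1 J + h0 γ * (realEnv3 M C a b z w y γ).gandE2 J))) :
    (∀ h0 h1 : ↥M.powerset → ℝ, Monotone h0 → Monotone h1 → (∀ γ, 0 ≤ h0 γ) → (∀ γ, h0 γ ≤ h1 γ) → ∀ J : ℤ,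
        0 ≤ Gen.gMt (realEnv3 M C a b y z w) h0 h1 J)
      ∧ (∀ h0 h1 : Bool × ↥M.powerset → ℝ, Monotone h0 → Monotone h1 → (∀ p, 0 ≤ h0 p) → (∀ p, h0 p ≤ h1 p) → ∀ J : ℤ,
        0 ≤ Gen.gMt (Gen.parE (realEnv3 M C a b y z w)) h0 h1 J)
      ∧ (∀ h : ↥M.powerset → ℝ, Monotone h → (∀ γ, 0 ≤ h γ) → ∀ J : ℤ, 0 ≤ ∑ γ, h γ * (realEnv3 M C a b y z w γ).gandDel J)
      ∧ (∀ h : ↥M.powerset → ℝ, Monotone h → (∀ γ, 0 ≤ h γ) → ∀ J : ℤ, 0 ≤ ∑ γ, h γ * (realEnv3 M C a b y z w γ).gandCon J)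
      ∧ (∀ h0 h1 : ↥M.powerset → ℝ, Monotone h0 → Monotone h1 → (∀ γ, 0 ≤ h0 γ) → (∀ γ, h0 γ ≤ h1 γ) → ∀ J : ℤ,
          0 ≤ ∑ γ, (h1 γ * (realEnv3 M C a b y z w γ).gandE1 J + h0 γ * (realEnv3 M C a b y z w γ).gandE2 J)) :=
  Gen.gfacts_of_relabel (finRotate 3).symm (fun β P => realEnv3_d_rot β P) h5

end Symmetry

section Transfers

variable {A F MA CA M C : Finset (Sym2 V)} {a m b uy vy uz vz : V} {w : Sym2 V}

/-- **The five facts pass from the real three-special environment of `𝓔` to that of `A ∥ 𝓔`** (`A` two-terminal series–parallel between the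
poles, edge-disjoint from the part `F ⊇ M ∪ C ∪ {y,z,w}` carrying the specials, vertex sets meeting only in the poles).
[cite: Grimmett2006, §3.8 Thm. (3.90) (pp. 61–62)] [cite: Wagner2006, Thm. 5.8(d), §5.3] -/
theorem realEnv3_attP_facts (hA : IsTTSP A a b) (hd : Disjoint A F)
    (hV : ∀ v : V, (∃ e ∈ A, v ∈ e) → (∃ e ∈ F, v ∈ e) → v = a ∨ v = b)
    (hMA : MA ⊆ A) (hCA : CA ⊆ A) (hM : insert s(uy, vy) (insert s(uz, vz) (insert w M)) ⊆ F) (hC : C ⊆ F)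
    (h5 : (∀ h0 h1 : ↥M.powerset → ℝ, Monotone h0 → Monotone h1 → (∀ γ, 0 ≤ h0 γ) → (∀ γ, h0 γ ≤ h1 γ) → ∀ J : ℤ,
        0 ≤ Gen.gMt (realEnv3 M C a b s(uy, vy) s(uz, vz) w) h0 h1 J)
      ∧ (∀ h0 h1 : Bool × ↥M.powerset → ℝ, Monotone h0 → Monotone h1 → (∀ p, 0 ≤ h0 p) → (∀ p, h0 p ≤ h1 p) → ∀ J : ℤ,
        0 ≤ Gen.gMt (Gen.parE (realEnv3 M C a b s(uy, vy) s(uz, vz) w)) h0 h1 J)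
      ∧ (∀ h : ↥M.powerset → ℝ, Monotone h → (∀ γ, 0 ≤ h γ) → ∀ J : ℤ, 0 ≤ ∑ γ, h γ * (realEnv3 M C a b s(uy, vy) s(uz, vz) w γ).gandDel J)
      ∧ (∀ h : ↥M.powerset → ℝ, Monotone h → (∀ γ, 0 ≤ h γ) → ∀ J : ℤ, 0 ≤ ∑ γ, h γ * (realEnv3 M C a b s(uy, vy) s(uz, vz) w γ).gandCon J)
      ∧ (∀ h0 h1 : ↥M.powerset → ℝ, Monotone h0 → Monotone h1 → (∀ γ, 0 ≤ h0 γ) → (∀ γ, h0 γ ≤ h1 γ) → ∀ J : ℤ,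
          0 ≤ ∑ γ, (h1 γ * (realEnv3 M C a b s(uy, vy) s(uz, vz) w γ).gandE1 J + h0 γ * (realEnv3 M C a b s(uy, vy) s(uz, vz) w γ).gandE2 J))) :
    (∀ h0 h1 : ↥(MA ∪ M).powerset → ℝ, Monotone h0 → Monotone h1 → (∀ γ, 0 ≤ h0 γ) → (∀ γ, h0 γ ≤ h1 γ) → ∀ J : ℤ,
        0 ≤ Gen.gMt (realEnv3 (MA ∪ M) (CA ∪ C) a b s(uy, vy) s(uz, vz) w) h0 h1 J)
      ∧ (∀ h0 h1 : Bool × ↥(MA ∪ M).powerset → ℝ, Monotone h0 → Monotone h1 → (∀ p, 0 ≤ h0 p) → (∀ p, h0 p ≤ h1 p) → ∀ J : ℤ,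
        0 ≤ Gen.gMt (Gen.parE (realEnv3 (MA ∪ M) (CA ∪ C) a b s(uy, vy) s(uz, vz) w)) h0 h1 J)
      ∧ (∀ h : ↥(MA ∪ M).powerset → ℝ, Monotone h → (∀ γ, 0 ≤ h γ) → ∀ J : ℤ, 0 ≤ ∑ γ, h γ * (realEnv3 (MA ∪ M) (CA ∪ C) a b s(uy, vy) s(uz, vz) w γ).gandDel J)
      ∧ (∀ h : ↥(MA ∪ M).powerset → ℝ, Monotone h → (∀ γ, 0 ≤ h γ) → ∀ J : ℤ, 0 ≤ ∑ γ, h γ * (realEnv3 (MA ∪ M) (CA ∪ C) a b s(uy, vy) s(uz, vz) w γ).gandCon J)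
      ∧ (∀ h0 h1 : ↥(MA ∪ M).powerset → ℝ, Monotone h0 → Monotone h1 → (∀ γ, 0 ≤ h0 γ) → (∀ γ, h0 γ ≤ h1 γ) → ∀ J : ℤ,
          0 ≤ ∑ γ, (h1 γ * (realEnv3 (MA ∪ M) (CA ∪ C) a b s(uy, vy) s(uz, vz) w γ).gandE1 J + h0 γ * (realEnv3 (MA ∪ M) (CA ∪ C) a b s(uy, vy) s(uz, vz) w γ).gandE2 J)) := by
  have hdM : Disjoint MA M := Finset.disjoint_of_subset_left hMA (Finset.disjoint_of_subset_right
    ((((Finset.subset_insert _ _).trans (Finset.subset_insert _ _)).trans (Finset.subset_insert _ _)).trans hM) hd)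
  let φ : ↥MA.powerset × ↥M.powerset ≃ ↥(MA ∪ M).powerset :=
    { toFun := fun p => ⟨p.1.1 ∪ p.2.1, Finset.mem_powerset.2
        (Finset.union_subset_union (Finset.mem_powerset.1 p.1.2) (Finset.mem_powerset.1 p.2.2))⟩
      invFun := fun δ => (⟨δ.1 ∩ MA, Finset.mem_powerset.2 Finset.inter_subset_right⟩,
        ⟨δ.1 ∩ M, Finset.mem_powerset.2 Finset.inter_subset_right⟩)
      left_inv := fun p => by
        obtain ⟨⟨X, hX⟩, ⟨Y, hY⟩⟩ := p
        have hX' := Finset.mem_powerset.1 hX; have hY' := Finset.mem_powerset.1 hY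
        refine Prod.ext (Subtype.ext ?_) (Subtype.ext ?_)
        · show (X ∪ Y) ∩ MA = X
          rw [Finset.union_inter_distrib_right, Finset.inter_eq_left.2 hX',
            Finset.disjoint_iff_inter_eq_empty.1 (Finset.disjoint_of_subset_left hY' hdM.symm), Finset.union_empty]
        · show (X ∪ Y) ∩ M = Y
          rw [Finset.union_inter_distrib_right, Finset.inter_eq_left.2 hY',
            Finset.disjoint_iff_inter_eq_empty.1 (Finset.disjoint_of_subset_left hX' hdM), Finset.empty_union]
      right_inv := fun δ => Subtype.ext (by
        show δ.1 ∩ MA ∪ δ.1 ∩ M = δ.1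
        rw [← Finset.inter_union_distrib_left, Finset.inter_eq_left.2 (Finset.mem_powerset.1 δ.2)]) }
  have hφ : Monotone φ := fun p q hpq => show (φ p).1 ⊆ (φ q).1 from Finset.union_subset_union hpq.1 hpq.2
  have hd' : ∀ (p : ↥MA.powerset × ↥M.powerset) (P : Finset (Fin 3)),
      (realEnv3 (MA ∪ M) (CA ∪ C) a b s(uy, vy) s(uz, vz) w (φ p)).d P =
        ⟨((Gen.attP (realSBox MA CA a b) (realEnv3 M C a b s(uy, vy) s(uz, vz) w) p).d P).lam + (-(2 * (Fintype.card V : ℤ))),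
          ((Gen.attP (realSBox MA CA a b) (realEnv3 M C a b s(uy, vy) s(uz, vz) w) p).d P).k1,
          ((Gen.attP (realSBox MA CA a b) (realEnv3 M C a b s(uy, vy) s(uz, vz) w) p).d P).k2⟩ := by
    rintro ⟨α, β⟩ P
    have e := acomb_realSDat0 hA hd hV hMA hCA hM hC (Finset.mem_powerset.1 α.2)
      (patSet3_subset s(uy, vy) s(uz, vz) w P (Finset.mem_powerset.1 β.2)) (Y := patSet3 s(uy, vy) s(uz, vz) w P (α.1 ∪ β.1))
      (by rw [union_patSet3])
    rw [Finset.union_insert] at e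
    exact PDat.eq_of_addLam e
  exact Gen.gtransfer_facts hφ hd' (Gen.gattP_facts (realSBox MA CA a b) (realEnv3 M C a b s(uy, vy) s(uz, vz) w) (realSBox_thmU hA hMA hCA) h5)

/-- **The five facts pass from the real three-special environment of `𝓔` (poles `m, b`) to that of `B · 𝓔`** (poles `a, b`; `B` two-terminal
series–parallel between `a, m`, edge-disjoint from the part `F` carrying the specials, vertex sets meeting only in `m`, `a` off `F`, `b` off `B`).
[cite: Grimmett2006, §3.8 Thm. (3.90) (pp. 61–62)] [cite: Wagner2006, Thm. 5.8(d), §5.3] -/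
theorem realEnv3_attS_facts (hA : IsTTSP A a m) (hd : Disjoint A F)
    (hV : ∀ v : V, (∃ e ∈ A, v ∈ e) → (∃ e ∈ F, v ∈ e) → v = m) (haF : ∀ e ∈ F, a ∉ e) (hbA : ∀ e ∈ A, b ∉ e)
    (ham : a ≠ m) (hbm : b ≠ m) (hab : a ≠ b)
    (hMA : MA ⊆ A) (hCA : CA ⊆ A) (hM : insert s(uy, vy) (insert s(uz, vz) (insert w M)) ⊆ F) (hC : C ⊆ F)
    (h5 : (∀ h0 h1 : ↥M.powerset → ℝ, Monotone h0 → Monotone h1 → (∀ γ, 0 ≤ h0 γ) → (∀ γ, h0 γ ≤ h1 γ) → ∀ J : ℤ,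
        0 ≤ Gen.gMt (realEnv3 M C m b s(uy, vy) s(uz, vz) w) h0 h1 J)
      ∧ (∀ h0 h1 : Bool × ↥M.powerset → ℝ, Monotone h0 → Monotone h1 → (∀ p, 0 ≤ h0 p) → (∀ p, h0 p ≤ h1 p) → ∀ J : ℤ,
        0 ≤ Gen.gMt (Gen.parE (realEnv3 M C m b s(uy, vy) s(uz, vz) w)) h0 h1 J)
      ∧ (∀ h : ↥M.powerset → ℝ, Monotone h → (∀ γ, 0 ≤ h γ) → ∀ J : ℤ, 0 ≤ ∑ γ, h γ * (realEnv3 M C m b s(uy, vy) s(uz, vz) w γ).gandDel J)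
      ∧ (∀ h : ↥M.powerset → ℝ, Monotone h → (∀ γ, 0 ≤ h γ) → ∀ J : ℤ, 0 ≤ ∑ γ, h γ * (realEnv3 M C m b s(uy, vy) s(uz, vz) w γ).gandCon J)
      ∧ (∀ h0 h1 : ↥M.powerset → ℝ, Monotone h0 → Monotone h1 → (∀ γ, 0 ≤ h0 γ) → (∀ γ, h0 γ ≤ h1 γ) → ∀ J : ℤ,
          0 ≤ ∑ γ, (h1 γ * (realEnv3 M C m b s(uy, vy) s(uz, vz) w γ).gandE1 J + h0 γ * (realEnv3 M C m b s(uy, vy) s(uz, vz) w γ).gandE2 J))) :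
    (∀ h0 h1 : ↥(MA ∪ M).powerset → ℝ, Monotone h0 → Monotone h1 → (∀ γ, 0 ≤ h0 γ) → (∀ γ, h0 γ ≤ h1 γ) → ∀ J : ℤ,
        0 ≤ Gen.gMt (realEnv3 (MA ∪ M) (CA ∪ C) a b s(uy, vy) s(uz, vz) w) h0 h1 J)
      ∧ (∀ h0 h1 : Bool × ↥(MA ∪ M).powerset → ℝ, Monotone h0 → Monotone h1 → (∀ p, 0 ≤ h0 p) → (∀ p, h0 p ≤ h1 p) → ∀ J : ℤ,
        0 ≤ Gen.gMt (Gen.parE (realEnv3 (MA ∪ M) (CA ∪ C) a b s(uy, vy) s(uz, vz) w)) h0 h1 J)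
      ∧ (∀ h : ↥(MA ∪ M).powerset → ℝ, Monotone h → (∀ γ, 0 ≤ h γ) → ∀ J : ℤ, 0 ≤ ∑ γ, h γ * (realEnv3 (MA ∪ M) (CA ∪ C) a b s(uy, vy) s(uz, vz) w γ).gandDel J)
      ∧ (∀ h : ↥(MA ∪ M).powerset → ℝ, Monotone h → (∀ γ, 0 ≤ h γ) → ∀ J : ℤ, 0 ≤ ∑ γ, h γ * (realEnv3 (MA ∪ M) (CA ∪ C) a b s(uy, vy) s(uz, vz) w γ).gandCon J)
      ∧ (∀ h0 h1 : ↥(MA ∪ M).powerset → ℝ, Monotone h0 → Monotone h1 → (∀ γ, 0 ≤ h0 γ) → (∀ γ, h0 γ ≤ h1 γ) → ∀ J : ℤ,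
          0 ≤ ∑ γ, (h1 γ * (realEnv3 (MA ∪ M) (CA ∪ C) a b s(uy, vy) s(uz, vz) w γ).gandE1 J + h0 γ * (realEnv3 (MA ∪ M) (CA ∪ C) a b s(uy, vy) s(uz, vz) w γ).gandE2 J)) := by
  have hdM : Disjoint MA M := Finset.disjoint_of_subset_left hMA (Finset.disjoint_of_subset_right
    ((((Finset.subset_insert _ _).trans (Finset.subset_insert _ _)).trans (Finset.subset_insert _ _)).trans hM) hd)
  let φ : ↥MA.powerset × ↥M.powerset ≃ ↥(MA ∪ M).powerset :=
    { toFun := fun p => ⟨p.1.1 ∪ p.2.1, Finset.mem_powerset.2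
        (Finset.union_subset_union (Finset.mem_powerset.1 p.1.2) (Finset.mem_powerset.1 p.2.2))⟩
      invFun := fun δ => (⟨δ.1 ∩ MA, Finset.mem_powerset.2 Finset.inter_subset_right⟩,
        ⟨δ.1 ∩ M, Finset.mem_powerset.2 Finset.inter_subset_right⟩)
      left_inv := fun p => by
        obtain ⟨⟨X, hX⟩, ⟨Y, hY⟩⟩ := p
        have hX' := Finset.mem_powerset.1 hX; have hY' := Finset.mem_powerset.1 hY
        refine Prod.ext (Subtype.ext ?_) (Subtype.ext ?_)
        · show (X ∪ Y) ∩ MA = X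
          rw [Finset.union_inter_distrib_right, Finset.inter_eq_left.2 hX',
            Finset.disjoint_iff_inter_eq_empty.1 (Finset.disjoint_of_subset_left hY' hdM.symm), Finset.union_empty]
        · show (X ∪ Y) ∩ M = Y
          rw [Finset.union_inter_distrib_right, Finset.inter_eq_left.2 hY',
            Finset.disjoint_iff_inter_eq_empty.1 (Finset.disjoint_of_subset_left hX' hdM), Finset.empty_union]
      right_inv := fun δ => Subtype.ext (by
        show δ.1 ∩ MA ∪ δ.1 ∩ M = δ.1
        rw [← Finset.inter_union_distrib_left, Finset.inter_eq_left.2 (Finset.mem_powerset.1 δ.2)]) }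
  have hφ : Monotone φ := fun p q hpq => show (φ p).1 ⊆ (φ q).1 from Finset.union_subset_union hpq.1 hpq.2
  have hd' : ∀ (p : ↥MA.powerset × ↥M.powerset) (P : Finset (Fin 3)),
      (realEnv3 (MA ∪ M) (CA ∪ C) a b s(uy, vy) s(uz, vz) w (φ p)).d P =
        ⟨((Gen.attS (realSBox MA CA a m) (realEnv3 M C m b s(uy, vy) s(uz, vz) w) p).d P).lam + (-(2 * (Fintype.card V : ℤ))),
          ((Gen.attS (realSBox MA CA a m) (realEnv3 M C m b s(uy, vy) s(uz, vz) w) p).d P).k1,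
          ((Gen.attS (realSBox MA CA a m) (realEnv3 M C m b s(uy, vy) s(uz, vz) w) p).d P).k2⟩ := by
    rintro ⟨α, β⟩ P
    have e := scomb_realSDat0 hd hV haF hbA ham hbm hab hMA hCA hM hC (Finset.mem_powerset.1 α.2)
      (patSet3_subset s(uy, vy) s(uz, vz) w P (Finset.mem_powerset.1 β.2)) (Y := patSet3 s(uy, vy) s(uz, vz) w P (α.1 ∪ β.1))
      (by rw [union_patSet3])
    rw [Finset.union_insert] at e
    exact PDat.eq_of_addLam e
  exact Gen.gtransfer_facts hφ hd' (Gen.gattS_facts (realSBox MA CA a m) (realEnv3 M C m b s(uy, vy) s(uz, vz) w) (realSBox_thmU hA hMA hCA) h5)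

end Transfers

end RootForm

end FK

end Summit.CriticalPhenomena.PercolationContinuityZ3.Theorems

end
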